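import Summits.ResolutionOfSingularities.ResolutionOfSingularities.Theorems.HilbertSamuelEliminationSigmaMaxModificationsCorridor3HypersurfaceValues
import Summits.ResolutionOfSingularities.ResolutionOfSingularities.Theorems.HilbertSamuelEliminationSigmaMaxModificationsCorridor3TameValueHypersurface
import Literature.RingTheory.HilbertSamuel.InitialFormOfElement
import Literature.RingTheory.HilbertSamuel.TangentConeInitialForms
import Literature.RingTheory.HilbertSamuel.HilbertFunctionBaseChange
import Literature.RingTheory.MvPolynomial.HomogeneousHilbertFunction
import Literature.RingTheory.MvPolynomial.NuInvariantBaseChange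
import Mathlib.Algebra.MvPolynomial.NoZeroDivisors
import Mathlib.RingTheory.RegularLocalRing.Defs
import HarnessLib

/-!
# `SigmaMaxModificationsCorridor3` (crux stmt-ResolutionOfSingularities-19249, child of
# `SigmaMaxModifications` stmt-ResolutionOfSingularities-18506, route HilbertSamuelElimination),
# chain w42 helper H1′: THE HILBERT FUNCTION OF A HYPERSURFACE SINGULARITY

[OURS · L1 W4.2] Helper H1′ of the typed helper programme for `stub_tameNu3`
(`run/shared/lean/pub/res-hironaka/L/w42/CRUX-PLAN.md` §2, `L/w42/helpers-v1.lean`: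
`stub_H1_hilbertFun_quotient_span_singleton`), proved: **for a regular local ring `S` of dimension
`e` and `g ∈ 𝔪^m ∖ 𝔪^{m+1}`, the Hilbert function of `S/(g)` is `hypersurfaceHFe e m`,
`n ↦ C(n+e-1, e-1) - [m ≤ n]·C(n-m+e-1, e-1)`** — the converse / sanity direction of the
Hilbert-function rigidity H1 (stub-2). NOT a statement of any manuscript.

Proof (CJS LNM 2270 §2.2, `gr_𝔪(S) = k[X_1, …, X_e]` for `S` regular, Matsumura Thm. 17.10):

* `mul_mem_initialFormsOf` — initial forms multiply: representatives `F(x) = f`, `G(x) = g` give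
  `(FG)(x) = fg` (any local ring, any generators);
* `mul_not_mem_pow` — in a REGULAR local ring the order is additive,
  `f ∈ 𝔪^v ∖ 𝔪^{v+1}`, `g ∈ 𝔪^w ∖ 𝔪^{w+1}` ⟹ `fg ∉ 𝔪^{v+w+1}` (the symbols have no relations,
  `symbolKer_eq_bot_of_isRegularLocalRing`, and `k[X]` is a domain); hence
  `mem_pow_sub_of_mul_mem_pow`: `sg ∈ 𝔪^μ` ⟹ `s ∈ 𝔪^{μ-m}`;
* `initialIdeal_span_singleton` — **`In_𝔪((g)) = (in_𝔪(g))`**: an initial form of degree `μ` of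
  an element `sg` of `(g)` is `in(s')·in(g)` for a representative `s'` of `s` of degree `μ - m`
  (uniqueness of initial forms in a regular local ring, `initialFormsOf_subsingleton`);
* `hilbertFunQuot_span_singleton` — the Hilbert function of `k[X_1, …, X_{t+1}]/(G)` for a
  non-zero form `G` of degree `m` is `hypersurfaceHFe (t+1) m` (Philippon's non-zero-divisor
  formula `hilbert_sup_span_add_hilbert_eq` with `I = 0` in degrees `≥ m`; `(G)_n = 0` for `n < m`);
* assembly `stub_H1_hilbertFun_quotient_span_singleton`: `H^{(0)}(S/(g)) = H(k[X]/J_{S/(g)})`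
  (`hilbertFunQuot_tangentConeIdeal`), `J_{S/(g)} = In_𝔪((g)) ⊗ k(S/(g))`
  (`tangentConeIdeal_quotient_eq_map_initialIdeal`, base field unchanged: `hilbertFunQuot_map`),
  `In_𝔪((g)) = (in(g))`, and the polynomial count. The hypotheses force `m ≥ 1` (else `g` is a
  unit and `S/(g) = 0` is not local) and `e ≥ 1` (else `𝔪 = 0`).

## Sources

* V. Cossart, U. Jannsen, S. Saito, LNM 2270 (2020): §2.2 (pp. 24, 27), Def. 2.13, Thm. 2.3.
  [CossartJannsenSaito2020]
* H. Matsumura, *Commutative Ring Theory*, CUP 1986, Thm. 17.10 (`gr` of a regular local ring).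
  [Matsumura1987]
* P. Philippon, Bull. SMF 114 (1986), Lemme 3.1 (hypersurface section of the Hilbert function).
  [Philippon1986]
-/

set_option linter.dupNamespace false -- mandated namespace of this single-conjunct summit

noncomputable section

open IsLocalRing MvPolynomial Module
open Literature.RingTheory.HilbertSamuel Literature.AlgebraicGeometry.Resolution
open Literature.RingTheory.MvPolynomial

namespace Summit.ResolutionOfSingularities.ResolutionOfSingularities.Theorems.SigmaMaxModificationsCorridor3.Helpers

universe u

/-! ## Products of initial forms (any local ring) -/

section Local

variable {A : Type u} [CommRing A] [IsLocalRing A] {e : ℕ} (x : Fin e → A)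

/-- **Initial forms multiply:** if `F̄` is an initial form of `f` of degree `v` and `Ḡ` one of `g`
of degree `w` (in the generators `x`), then `F̄Ḡ` is an initial form of `fg` of degree `v + w`
(representatives multiply: `(FG)(x) = F(x)G(x)`). [cite: CossartJannsenSaito2020, §2.2 (p. 24)] -/
theorem mul_mem_initialFormsOf {f g : A} {v w : ℕ}
    {F G : MvPolynomial (Fin e) (ResidueField A)} (hF : F ∈ initialFormsOf x f v)
    (hG : G ∈ initialFormsOf x g w) : F * G ∈ initialFormsOf x (f * g) (v + w) := by
  obtain ⟨F', hF', hF'f, rfl⟩ := hF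
  obtain ⟨G', hG', hG'g, rfl⟩ := hG
  exact ⟨F' * G', hF'.mul hG', by rw [map_mul, hF'f, hG'g], map_mul _ _ _⟩

/-- An initial form of degree `v` of an element NOT in `𝔪^{v+1}` is non-zero.
[cite: CossartJannsenSaito2020, §2.2 (p. 24)] -/
theorem ne_zero_of_mem_initialFormsOf (hx : Ideal.span (Set.range x) = maximalIdeal A) {f : A}
    {v : ℕ} {F : MvPolynomial (Fin e) (ResidueField A)} (hF : F ∈ initialFormsOf x f v)
    (hf : f ∉ maximalIdeal A ^ (v + 1)) : F ≠ 0 := by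
  intro h0
  apply hf
  rw [mem_pow_succ_iff_of_mem_initialFormsOf x hx hF, h0]
  exact zero_mem _

end Local

/-! ## Regular local rings: the order is additive, `In((g)) = (in g)` -/

section Regular

variable {R : Type u} [CommRing R] [IsRegularLocalRing R] {d : ℕ}
  (hd : (maximalIdeal R).spanFinrank = d) (x : Fin d → R)
  (hx : Ideal.span (Set.range x) = maximalIdeal R)

include hd hx in
/-- **The order is additive in a regular local ring:** `f ∈ 𝔪^v ∖ 𝔪^{v+1}` and
`g ∈ 𝔪^w ∖ 𝔪^{w+1}` give `fg ∉ 𝔪^{v+w+1}` (`gr_𝔪(R) = k[X]` is a domain: the product of the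
two non-zero initial forms is a non-zero initial form of `fg` of degree `v + w`; `W_n(R) = 0` is
stub-2's `symbolForms_eq_bot_of_isRegularLocalRing`, `…Corridor3TameValueHypersurface.lean`).
[cite: Matsumura1987, Thm. 17.10] [cite: CossartJannsenSaito2020, §2.2 (p. 24)] -/
theorem mul_not_mem_pow {f g : R} {v w : ℕ} (hf : f ∈ maximalIdeal R ^ v)
    (hf' : f ∉ maximalIdeal R ^ (v + 1)) (hg : g ∈ maximalIdeal R ^ w)
    (hg' : g ∉ maximalIdeal R ^ (w + 1)) : f * g ∉ maximalIdeal R ^ (v + w + 1) := by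
  obtain ⟨F, hF⟩ := (initialFormsOf_nonempty_iff x hx f v).mpr hf
  obtain ⟨G, hG⟩ := (initialFormsOf_nonempty_iff x hx g w).mpr hg
  have hF0 : F ≠ 0 := ne_zero_of_mem_initialFormsOf x hx hF hf'
  have hG0 : G ≠ 0 := ne_zero_of_mem_initialFormsOf x hx hG hg'
  intro hfg
  have hFG : F * G ∈ symbolForms x hx (v + w) :=
    (mem_pow_succ_iff_of_mem_initialFormsOf x hx (mul_mem_initialFormsOf x hF hG)).mp hfg
  rw [symbolForms_eq_bot_of_isRegularLocalRing hd x hx, Submodule.mem_bot] at hFG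
  exact mul_ne_zero hF0 hG0 hFG

include hd hx in
/-- **Division by the order:** if `g ∈ 𝔪^m ∖ 𝔪^{m+1}` and `sg ∈ 𝔪^μ` then `s ∈ 𝔪^{μ-m}`
(`v(sg) = v(s) + m`). [cite: Matsumura1987, Thm. 17.10] -/
theorem mem_pow_sub_of_mul_mem_pow {s g : R} {m μ : ℕ} (hg : g ∈ maximalIdeal R ^ m)
    (hg' : g ∉ maximalIdeal R ^ (m + 1)) (h : s * g ∈ maximalIdeal R ^ μ) :
    s ∈ maximalIdeal R ^ (μ - m) := by
  by_cases hs0 : s = 0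
  · rw [hs0]
    exact zero_mem _
  have htop : mOrder s ≠ ⊤ := fun h' => hs0 ((mOrder_eq_top_iff_eq_zero s).mp h')
  have hs := mem_pow_toNat_mOrder htop
  have hs' := not_mem_pow_toNat_mOrder_succ htop
  have key := mul_not_mem_pow hd x hx hs hs' hg hg'
  have hle : μ ≤ (mOrder s).toNat + m := by
    by_contra hlt
    exact key (Ideal.pow_le_pow_right (by omega) h)
  exact Ideal.pow_le_pow_right (by omega) hs

include hd hx in
/-- Every initial form (of any degree `μ`) of an element of the principal ideal `(g)`,
`g ∈ 𝔪^m ∖ 𝔪^{m+1}`, is a multiple of the initial form `G` of `g`: it is `S̄'·G` for a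
representative `S'` of degree `μ - m` of the cofactor (uniqueness of initial forms in a regular
local ring), or `0` if `μ < m`. [cite: CossartJannsenSaito2020, §2.2 (p. 24), Def. 2.17] -/
theorem mem_span_of_mem_initialForms_span_singleton {g : R} {m : ℕ}
    (hg : g ∈ maximalIdeal R ^ m) (hg' : g ∉ maximalIdeal R ^ (m + 1))
    {G : MvPolynomial (Fin d) (ResidueField R)} (hG : G ∈ initialFormsOf x g m) (μ : ℕ)
    {Φ : MvPolynomial (Fin d) (ResidueField R)} (hΦ : Φ ∈ initialForms x (Ideal.span {g}) μ) :
    Φ ∈ Ideal.span {G} := by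
  obtain ⟨F, hF, hFJ, rfl⟩ := hΦ
  obtain ⟨s, hs⟩ := Ideal.mem_span_singleton'.mp hFJ
  have hμ : s * g ∈ maximalIdeal R ^ μ := by
    rw [hs]
    exact eval_mem_pow_of_isHomogeneous x hx hF
  have hΦ' : MvPolynomial.map (residue R) F ∈ initialFormsOf x (s * g) μ := ⟨F, hF, hs.symm, rfl⟩
  by_cases hm : m ≤ μ
  · have hsμ : s ∈ maximalIdeal R ^ (μ - m) := mem_pow_sub_of_mul_mem_pow hd x hx hg hg' hμ
    rw [← hx] at hsμ
    obtain ⟨S', hS', hS's⟩ := exists_isHomogeneous_of_mem_span_pow x (μ - m) hsμ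
    have hS : MvPolynomial.map (residue R) S' ∈ initialFormsOf x s (μ - m) := ⟨S', hS', hS's, rfl⟩
    have hprod := mul_mem_initialFormsOf x hS hG
    rw [Nat.sub_add_cancel hm] at hprod
    rw [initialFormsOf_subsingleton hd x hx (s * g) μ hΦ' hprod]
    exact Ideal.mul_mem_left _ _ (Ideal.mem_span_singleton_self G)
  · have h1 : s * g ∈ maximalIdeal R ^ (μ + 1) :=
      Ideal.pow_le_pow_right (by omega) (Ideal.mul_mem_left _ s hg)
    have h0 : MvPolynomial.map (residue R) F ∈ symbolForms x hx μ :=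
      (mem_pow_succ_iff_of_mem_initialFormsOf x hx hΦ').mp h1
    rw [symbolForms_eq_bot_of_isRegularLocalRing hd x hx, Submodule.mem_bot] at h0
    rw [h0]
    exact zero_mem _

include hd hx in
/-- **`In_𝔪((g)) = (in_𝔪(g))` in a regular local ring:** the ideal of initial forms of a
principal ideal is principal, generated by the initial form of the generator — `(g)` is a
standard base of itself (CJS Def. 2.17). [cite: CossartJannsenSaito2020, §2.2 (p. 24), Def. 2.17]
[cite: Matsumura1987, Thm. 17.10] -/
theorem initialIdeal_span_singleton {g : R} {m : ℕ} (hg : g ∈ maximalIdeal R ^ m)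
    (hg' : g ∉ maximalIdeal R ^ (m + 1)) {G : MvPolynomial (Fin d) (ResidueField R)}
    (hG : G ∈ initialFormsOf x g m) :
    initialIdeal x (Ideal.span {g}) = Ideal.span {G} := by
  apply le_antisymm
  · rw [initialIdeal, Ideal.span_le]
    intro Φ hΦ
    obtain ⟨μ, hμ⟩ := Set.mem_iUnion.mp hΦ
    exact mem_span_of_mem_initialForms_span_singleton hd x hx hg hg' hG μ hμ
  · rw [Ideal.span_le, Set.singleton_subset_iff]
    exact initialForms_le_initialIdeal x _ m
      (initialFormsOf_subset_initialForms x (Ideal.mem_span_singleton_self g) m hG)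

end Regular

/-! ## The Hilbert function of `k[X_1, …, X_{t+1}]/(G)` for a form `G` of degree `m` -/

section Poly

variable {κ : Type u} [Field κ]

/-- Below the degree of `G` the principal ideal `(G)` has no forms: `(G)_n = 0` for `n < deg G`.
[folklore] -/
theorem idealDegree_span_singleton_eq_bot_of_lt {t m n : ℕ} {G : MvPolynomial (Fin t) κ}
    (hG : G.IsHomogeneous m) (hn : n < m) : idealDegree (Ideal.span {G}) n = ⊥ := by
  rw [eq_bot_iff]
  rintro f ⟨hf, hfn⟩
  rw [Submodule.mem_bot]
  by_contra hf0
  obtain ⟨r, rfl⟩ := Ideal.mem_span_singleton'.mp (show f ∈ Ideal.span {G} from hf)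
  have hr0 : r ≠ 0 := left_ne_zero_of_mul hf0
  have hG0 : G ≠ 0 := right_ne_zero_of_mul hf0
  have h1 : (r * G).totalDegree = n := hfn.totalDegree hf0
  have h2 : (r * G).totalDegree = r.totalDegree + G.totalDegree := totalDegree_mul_of_isDomain hr0 hG0
  have h3 : G.totalDegree = m := hG.totalDegree hG0
  omega

/-- **The Hilbert function of a hypersurface in graded form:** for a non-zero form `G` of degree
`m` in `k[X_1, …, X_{t+1}]`, `H(k[X]/(G)) = hypersurfaceHFe (t+1) m`
(`= C(n+t, t) - [m ≤ n]·C(n-m+t, t)`): in degrees `n = k + m` by Philippon's non-zero-divisor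
formula `H((G); k+m) + H(0; k) = H(0; k+m)` (`k[X]` is a domain), in degrees `n < m` because
`(G)_n = 0`. [cite: Philippon1986, Lemme 3.1] [cite: CossartJannsenSaito2020, Def. 2.13] -/
theorem hilbertFunQuot_span_singleton {t m : ℕ} {G : MvPolynomial (Fin (t + 1)) κ}
    (hG : G.IsHomogeneous m) (hG0 : G ≠ 0) :
    hilbertFunQuot κ (t + 1) (Ideal.span {G}) = hypersurfaceHFe (t + 1) m := by
  classical
  funext n
  have hSn : ∀ n, finrank κ (homogeneousSubmodule (Fin (t + 1)) κ n) = (n + t).choose t :=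
    fun n => by
      rw [finrank_homogeneousSubmodule_fin, show n + (t + 1) - 1 = n + t by omega,
        Nat.choose_symm_add]
  by_cases hmn : m ≤ n
  · obtain ⟨k, rfl⟩ : ∃ k, n = k + m := ⟨n - m, by omega⟩
    have hbot : IsHomogeneousIdeal (⊥ : Ideal (MvPolynomial (Fin (t + 1)) κ)) := by
      intro f hf i
      rw [Ideal.mem_bot] at hf ⊢
      rw [hf, map_zero]
    have hnzd : ∀ f, G * f ∈ (⊥ : Ideal (MvPolynomial (Fin (t + 1)) κ)) →
        f ∈ (⊥ : Ideal (MvPolynomial (Fin (t + 1)) κ)) := fun f hf => by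
      rw [Ideal.mem_bot] at hf ⊢
      exact (mul_eq_zero.mp hf).resolve_left hG0
    have h := hilbert_sup_span_add_hilbert_eq ((isHomogeneousIdeal_iff _).mp hbot) hG0 hG hnzd k
    rw [bot_sup_eq, idealDegree_bot, idealDegree_bot, finrank_bot, Nat.sub_zero, Nat.sub_zero,
      hSn, hSn] at h
    rw [hilbertFunQuot, hSn, hypersurfaceHFe_apply, if_pos hmn,
      show k + m + (t + 1) - 1 = k + m + t by omega, show t + 1 - 1 = t by omega,
      show k + m - m + (t + 1) - 1 = k + t by omega]
    omega
  · rw [hilbertFunQuot, idealDegree_span_singleton_eq_bot_of_lt hG (by omega), finrank_bot,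
      Nat.sub_zero, hSn, hypersurfaceHFe_apply_of_lt (by omega),
      show n + (t + 1) - 1 = n + t by omega, show t + 1 - 1 = t by omega]

end Poly

/-! ## H1′: the Hilbert function of `S/(g)` -/

/-- **H1′ (the planner's form, `L/w42/helpers-v1.lean`, signature verbatim): the Hilbert function of
a hypersurface singularity.** For a regular local ring `S` of dimension `e` and
`g ∈ 𝔪^m ∖ 𝔪^{m+1}` (order exactly `m`), the local ring `S/(g)` has Hilbert function
`H^{(0)}(S/(g)) = hypersurfaceHFe e m`, `n ↦ C(n+e-1, e-1) - [m ≤ n]·C(n-m+e-1, e-1)`.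
Proof: `H^{(0)}(S/(g)) = H(k[X_1,…,X_e]/J_{S/(g)})` (`hilbertFunQuot_tangentConeIdeal`) with
`J_{S/(g)} = In_𝔪((g))` up to the (trivial) change of residue field
(`tangentConeIdeal_quotient_eq_map_initialIdeal`, `hilbertFunQuot_map`), `In_𝔪((g)) = (in g)`
(`initialIdeal_span_singleton`, `gr_𝔪(S) = k[X]` a domain) and the count
`hilbertFunQuot_span_singleton`. The instance hypothesis forces `m ≥ 1` (for `m = 0`, `g` is a
unit and `S/(g) = 0`), and then `e ≥ 1`.
[cite: CossartJannsenSaito2020, §2.2 (p. 27), Def. 2.13, Thm. 2.3] [cite: Matsumura1987, Thm. 17.10] -/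
theorem stub_H1_hilbertFun_quotient_span_singleton {S : Type u} [CommRing S] [IsRegularLocalRing S]
    {e m : ℕ} (he : ringKrullDim S = e) {g : S} (hg : g ∈ maximalIdeal S ^ m)
    (hg' : g ∉ maximalIdeal S ^ (m + 1)) [IsLocalRing (S ⧸ Ideal.span {g})] :
    hilbertFun (S ⧸ Ideal.span {g}) = hypersurfaceHFe e m := by
  -- the embedding dimension is `e`
  have hd : (maximalIdeal S).spanFinrank = e := by
    have h := IsRegularLocalRing.spanFinrank_maximalIdeal (R := S)
    rw [he] at h
    exact_mod_cast h
  obtain ⟨x, hx⟩ := exists_span_range_eq_maximalIdeal S hd.le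
  -- `m ≥ 1`: otherwise `g` is a unit and `S/(g)` is the zero ring, which is not local
  have hm : 1 ≤ m := by
    by_contra h0
    have h0 : m = 0 := by omega
    subst h0
    have hunit : IsUnit g := by
      by_contra hu
      exact hg' (by rw [zero_add, pow_one]; exact (IsLocalRing.mem_maximalIdeal g).mpr hu)
    have htop : Ideal.span {g} = ⊤ := Ideal.span_singleton_eq_top.mpr hunit
    have hsub : Subsingleton (S ⧸ Ideal.span {g}) := Ideal.Quotient.subsingleton_iff.mpr htop
    exact false_of_nontrivial_of_subsingleton (S ⧸ Ideal.span {g})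
  -- `e ≥ 1`: otherwise `𝔪 = 0` and `g ∈ 𝔪^m = 0` would lie in `𝔪^{m+1}`
  have he1 : 1 ≤ e := by
    by_contra h0
    have h0 : e = 0 := by omega
    subst h0
    have hbot : maximalIdeal S = ⊥ := by
      rw [← hx, Set.range_eq_empty, Ideal.span_empty]
    have hg0 : g ∈ (⊥ : Ideal S) := by
      rw [← hbot]
      exact Ideal.pow_le_self (by omega) hg
    rw [Ideal.mem_bot] at hg0
    exact hg' (by rw [hg0]; exact zero_mem _)
  obtain ⟨t, rfl⟩ : ∃ t, e = t + 1 := ⟨e - 1, by omega⟩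
  -- the initial form of `g`
  set J : Ideal S := Ideal.span {g} with hJ
  have hg0 : g ≠ 0 := fun h => hg' (by rw [h]; exact zero_mem _)
  have hord : mOrder g = m := (mOrder_eq_natCast_iff g m).mpr ⟨hg, hg'⟩
  have hordn : (mOrder g).toNat = m := by rw [hord, ENat.toNat_coe]
  have hG : inForm x g ∈ initialFormsOf x g m := by
    have h := inForm_mem_initialFormsOf x hx hg0
    rwa [hordn] at h
  have hG0 : inForm x g ≠ 0 := inForm_ne_zero x hx hg0
  have hGhom : (inForm x g).IsHomogeneous m := by
    have h := isHomogeneous_inForm x hx g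
    rwa [hordn] at h
  -- `In((g)) = (in g)` is homogeneous
  have hIn : initialIdeal x J = Ideal.span {inForm x g} :=
    initialIdeal_span_singleton hd x hx hg hg' hG
  have hhom : IsHomogeneousIdeal (initialIdeal x J) := by
    rw [hIn]
    exact isHomogeneousIdeal_span_of_isHomogeneous fun f hf =>
      ⟨m, by rw [Set.mem_singleton_iff.mp hf]; exact hGhom⟩
  -- the chain of Hilbert functions
  rw [← hilbertFunQuot_tangentConeIdeal (fun i => Ideal.Quotient.mk J (x i))
      (span_range_mk_comp_eq x hx J),
    tangentConeIdeal_quotient_eq_map_initialIdeal x hx J,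
    hilbertFunQuot_map (ResidueField.map (Ideal.Quotient.mk J)) hhom, hIn,
    hilbertFunQuot_span_singleton hGhom hG0]

/-- **H1′ in generators form** (no `ringKrullDim`): for a regular local ring `R` with
`(maximalIdeal R).spanFinrank = d` and `g ∈ 𝔪^m ∖ 𝔪^{m+1}`,
`H^{(0)}(R/(g)) = hypersurfaceHFe d m`. [cite: CossartJannsenSaito2020, §2.2 (p. 27), Thm. 2.3]
[cite: Matsumura1987, Thm. 17.10] -/
theorem hilbertFun_quotient_span_singleton {R : Type u} [CommRing R] [IsRegularLocalRing R]
    {d m : ℕ} (hd : (maximalIdeal R).spanFinrank = d) {g : R} (hg : g ∈ maximalIdeal R ^ m)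
    (hg' : g ∉ maximalIdeal R ^ (m + 1)) [IsLocalRing (R ⧸ Ideal.span {g})] :
    hilbertFun (R ⧸ Ideal.span {g}) = hypersurfaceHFe d m := by
  refine stub_H1_hilbertFun_quotient_span_singleton ?_ hg hg'
  rw [← IsRegularLocalRing.spanFinrank_maximalIdeal (R := R), hd]

end Summit.ResolutionOfSingularities.ResolutionOfSingularities.Theorems.SigmaMaxModificationsCorridor3.Helpers

end
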